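import Summits.QuantumFields.YangMills.Theorems.AlphaInputsT3ACv3AdaptedClassX
import Summits.QuantumFields.YangMills.Theorems.AlphaInputsT3ACv3AvgIterLocality
import Summits.QuantumFields.YangMills.Theorems.AlphaInputsT3ACHistories
import HarnessLib

/-!
# `AlphaInputsT3ACv3StartOmegaSat` — START for the (FL) `hLift` binder: **THE TWO SATURATION BINDERS OF THE START CERTIFICATES AT THE BINDER'S REGION `Ω_{k+1}(h)`** — `hsat` of
# `htwo_of_sat` (`x ∈ Ω ↔ toFine k (iterBlockOf k x) ∈ Ω`) and `hsatR` of `startSmall_cert` (`toFine s z ∈ Ω ↔ toFine (s+1) (blockOf z) ∈ Ω`, `s < k`), both from ★alpha-2's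
# `mem_Omega_iff_of_coarsen_eq` («Ω_j is a union of blocks of every level ≤ j») — lane `pub-balaban3d` ∕ cell `ym3-torus`, seat `ym-ust-19936-w1` (g2, LEAD)

WHY (PROGRESS 7; M22).  The START certificates display saturation abstractly; at the binder's region they are these two 5-line facts.
WHAT IS HERE: `omega_sat`, `omega_satR`.
HONEST FRAMING.  Bookkeeping; (FL)∕`hLift` NOT proved; count-neutral helper toward R3 2′ (items 19936∕19935); registry untouched; nothing about d = 4, the continuum, or a mass gap;
YM₃ on T³ is rung R3, not Clay.

References: T. Bałaban, Commun. Math. Phys. 102 (1985) 255–275 [Balaban1985UV3] ((38)–(39) p.266).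
-/

set_option autoImplicit false

namespace Summit.QuantumFields.YangMills.Theorems.TubeStart

open Literature.MathematicalPhysics.QuantumFieldTheory.Balaban1983to89
open Literature.MathematicalPhysics.QuantumFieldTheory.Balaban1983to89.B5Eq118OneStroke (iterBlockOf)
open Literature.MathematicalPhysics.QuantumFieldTheory.Balaban1983to89.B10Eq38TorusDomains (toFine)
open Summit.QuantumFields.Balaban3D.Carriers
open Summit.QuantumFields.YangMills.Theorems.AvgIterLocality (coarsen_eq_iterBlockOf)

variable {P : Params} (M₁ : ℕ) (Rcol : ℕ → ℕ) {k : ℕ} (hk : k ≤ P.m + P.K) (h : Hist P (k + 1))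
include hk

/-- **`hsat` AT `Ω_{k+1}(h)`**: membership depends only on the level-`k` block, read at the block's centre. [cite: Balaban1985UV3, (39) p.266] -/
theorem omega_sat (x : Site P 0) : x ∈ Omega M₁ Rcol (k + 1) h (k + 1) ↔ toFine k (iterBlockOf k x) ∈ Omega M₁ Rcol (k + 1) h (k + 1) := by
  refine mem_Omega_iff_of_coarsen_eq M₁ Rcol h (Nat.le_succ k) le_rfl ?_
  rw [coarsen_toFine k hk, coarsen_eq_iterBlockOf]

/-- **`hsatR` AT `Ω_{k+1}(h)`**: level by level, the centre of an `s`-block and the centre of its `(s+1)`-block are in Ω together (`s < k`). [cite: Balaban1985UV3, (39) p.266] -/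
theorem omega_satR : ∀ s, s < k → ∀ z : Site P s, toFine s z ∈ Omega M₁ Rcol (k + 1) h (k + 1) ↔ toFine (s + 1) (blockOf z) ∈ Omega M₁ Rcol (k + 1) h (k + 1) := by
  intro s hs z
  refine mem_Omega_iff_of_coarsen_eq M₁ Rcol h (j' := s + 1) (by omega) le_rfl ?_
  rw [coarsen_succ, coarsen_toFine s (by omega), coarsen_toFine (s + 1) (by omega)]

end Summit.QuantumFields.YangMills.Theorems.TubeStart
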